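import Mathlib
import HarnessLib
import Summits.NavierStokesRegularity.NavierStokesRegularity.Theorems.WakeRatchetMinimalViscousBlowupReignition
import Summits.NavierStokesRegularity.NavierStokesRegularity.Theorems.WakeRatchetMinimalViscousBlowupLevelGrowth

/-!
# Route `WakeRatchet`, crux `MinimalViscousBlowup` (stmt-NavierStokesRegularity-22743) — LINE g12-2 (ns-idea-1 g12, card «monotone quantity hunt»):
# RE-IGNITION, part 5/5 — (FC′) ⇒ BOUNDED RETREAT DEPTH

ns-idea-1 g12's kernel-checked file `lines/g12-2/Reignition.lean` (sha16 d946145192243467, 872 l.; evidence on ⟨22743⟩), landed VERBATIM by the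
hand ns-qj-p1 g7 in five tree-sized files (decl texts byte-identical; only the module docstrings are split):
`…ShellFence` (§1–§2) · `…UpperBlock` (§3) · `…Reignition` (§4) · `…LevelGrowth` (§5) · `…RetreatDepth` (§6).
MODEL lattice only (Tao's NS-scaled `ν`-viscous cascade lattice, `m = 4`; nothing about Navier–Stokes; no NS regularity statement is proved).
`--supports stmt-NavierStokesRegularity-22743 --as helper`.

* `retreatDepth_of_frontClock` — along an enveloped blow-up (S4 binders), the fired front clock (FC′) (shell `m` fired by `t` forces
  `T − t ≤ Kλ^{−2m}`) implies that the cascade never retreats more than a FIXED number `d` of shells below its deepest fired shell: at every later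
  time some shell `n ≥ m − d` is above the darkness level `ν²/(32768λ¹⁹)` (`reignition` + `level_growth_le` against the `Kλ^{−2m}` the clock leaves;
  `m < d` ⇒ global lull, excluded by `supLevel_maxPrinciple`).  Use (HEART-RG §10): `S5b♭ ⟺ (H1) ∧ (H2″)` — the retreat depth (H2″) is NECESSARY.
[cite: Tao2016AveragedNS, §4 (4.1)–(4.3), Lemma 4.1 (4.5), §5; BarbatoMorandinRomito2011, §3.1]
-/

noncomputable section

set_option linter.dupNamespace false

open Set Filter Topology
open Literature.Analysis.FluidPDE Literature.Analysis.FluidPDE.TaoCascade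

namespace Summit.NavierStokesRegularity.NavierStokesRegularity.Theorems.MinimalViscousBlowup.ThresholdRay

/-! ### §6 (FC′) ⇒ bounded retreat depth -/

/-- **(FC′) ⇒ (H2″): bounded retreat depth.**  Along an enveloped blow-up of the `ν`-viscous lattice (S4 binders), the fired front clock
`(FC′)` — shell `m` fired (`λᵐ‖X_m(s₀)‖² ≥ ν²/(32768λ¹⁶)`) by time `t` forces `T − t ≤ K λ^{−2m}` — implies that the cascade never retreats
more than a FIXED number `d` of shells below its deepest fired shell: at every later time `s` some shell `n ≥ m − d` is above the darkness level
`ν²/(32768λ¹⁹)`.  Proof: otherwise every shell `> m − d` is dark at `s`, so (`reignition`) shell `m − d` climbs from `≤ ν²/(32768λ¹⁹)` to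
`> ν²/(16384λ¹⁹)` before `T`, which takes time `≥ ν²λ^{−2(m−d)}/(16384·512·C√C·λ¹⁹)` (`level_growth_le`), more than the `Kλ^{−2m}` the clock
leaves once `λ^{2d} > 512·16384λ¹⁹·K·C√C/ν²`; if `m < d` all shells are dark at `s` and `supLevel_maxPrinciple` forbids the re-ignition outright.
This is the converse half making `S5b♭ ⟺ (H1) ∧ (H2″)` (HEART-RG §10).  MODEL lattice only.
[cite: Tao2016AveragedNS, §4 (4.3), Lemma 4.1 (4.5), §5; BarbatoMorandinRomito2011, §3.1] -/
theorem retreatDepth_of_frontClock {ε₀ ν T C K : ℝ} (hε : 0 < ε₀) (hν : 0 < ν) (hT : 0 < T)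
    {α : Fin 4 → Fin 4 → Fin 4 → ℤ × ℤ × ℤ → ℝ} (hcan : IsCancellingCoeff α)
    (hα1 : ∀ i₁ i₂ i₃, |α i₁ i₂ i₃ (0, 0, 1)| ≤ 1) {X : Fin 4 → ℤ → ℝ → ℝ}
    (hcd : ∀ i n, ContDiffOn ℝ 1 (X i n) (Ico 0 T))
    (hlow : ∀ i n t, n < 0 → X i n t = 0)
    (hmot : ∀ i n t, 0 ≤ t → t < T → derivWithin (X i n) (Ici 0) t =
      quadTerm ε₀ α X i n t - ν * (1 + ε₀) ^ ((2 : ℝ) * n) * X i n t)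
    (hreg : ∀ T' : ℝ, 0 < T' → T' < T → ∃ M : ℝ, ∀ t : ℝ, 0 ≤ t → t ≤ T' →
      ∀ (i : Fin 4) (n : ℤ), (1 + (1 + ε₀) ^ ((10 : ℝ) * n)) * |X i n t| ≤ M)
    (hblow : ∀ M : ℝ, ∃ t : ℝ, 0 ≤ t ∧ t < T ∧
      ∃ (i : Fin 4) (n : ℤ), M < (1 + (1 + ε₀) ^ ((10 : ℝ) * n)) * |X i n t|)
    (henv : ∀ (n : ℤ) (t : ℝ), 0 ≤ t → t < T → (1 + ε₀) ^ n * ‖shellVec X n t‖ ^ 2 ≤ C)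
    (hFC : ∀ (m : ℕ) (t : ℝ), 0 ≤ t → t < T →
      (∃ s, 0 ≤ s ∧ s ≤ t ∧ 1 / (32768 * (1 + ε₀) ^ 16) * ν ^ 2 ≤ (1 + ε₀) ^ m * ‖shellVec X m s‖ ^ 2) →
      T - t ≤ K / (1 + ε₀) ^ (2 * m)) :
    ∃ d : ℕ, ∀ (m : ℕ) (s₀ s : ℝ), 0 ≤ s₀ → s₀ ≤ s → s < T →
      1 / (32768 * (1 + ε₀) ^ 16) * ν ^ 2 ≤ (1 + ε₀) ^ m * ‖shellVec X m s₀‖ ^ 2 →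
      ∃ n : ℕ, m ≤ n + d ∧ 1 / (32768 * (1 + ε₀) ^ 19) * ν ^ 2 < (1 + ε₀) ^ n * ‖shellVec X n s‖ ^ 2 := by
  have hl0 : (0 : ℝ) < 1 + ε₀ := by linarith
  have hl1 : (1 : ℝ) < 1 + ε₀ := by linarith
  have hν2 : 0 < ν ^ 2 := pow_pos hν 2
  have hC0 : 0 ≤ C := le_trans (by positivity) (henv 0 0 le_rfl hT)
  have hlow' : ∀ i n t, n < 0 → 0 ≤ t → X i n t = 0 := fun i n t hn _ => hlow i n t hn
  -- the darkness constant `c = 1/(16384 λ¹⁹)`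
  obtain ⟨c, hc⟩ : ∃ c : ℝ, c = 1 / (16384 * (1 + ε₀) ^ 19) := ⟨_, rfl⟩
  have hc0 : 0 < c := by rw [hc]; positivity
  have hc1 : c ≤ 1 / (16384 * (1 + ε₀) ^ 19) := hc.le
  have hc2 : 1 / (32768 * (1 + ε₀) ^ 19) * ν ^ 2 = c / 2 * ν ^ 2 := by
    rw [hc]; field_simp; ring
  have hcs : c < 1 / 16384 := by
    rw [hc]
    apply one_div_lt_one_div_of_lt (by norm_num)
    have : (1 : ℝ) < (1 + ε₀) ^ 19 := one_lt_pow₀ hl1 (by norm_num)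
    nlinarith
  -- the retreat depth `d`: `λ^{2d} > 512 K C√C/(cν²)`
  have h2 : (1 : ℝ) < (1 + ε₀) ^ 2 := one_lt_pow₀ hl1 (by norm_num)
  obtain ⟨d, hd⟩ := pow_unbounded_of_one_lt (512 * K * C * Real.sqrt C / (c * ν ^ 2)) h2
  have hd' : 512 * K * C * Real.sqrt C < c * ν ^ 2 * ((1 + ε₀) ^ 2) ^ d := by
    have := (div_lt_iff₀ (by positivity : (0 : ℝ) < c * ν ^ 2)).1 hd
    linarith [this]
  refine ⟨d, fun m s₀ s hs₀ hs₀s hsT hfired => ?_⟩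
  have hs0 : 0 ≤ s := hs₀.trans hs₀s
  by_contra hno
  push Not at hno
  rw [hc2] at hno
  rcases lt_or_ge m d with hmd | hmd
  · -- `m < d`: every shell is dark at `s` — a global lull, impossible before a blow-up
    have hall : ∀ n : ℕ, (1 + ε₀) ^ n * ‖shellVec X n s‖ ^ 2 ≤ c / 2 * ν ^ 2 := fun n => hno n (by omega)
    obtain ⟨t₁, hst₁, ht₁T, hfire⟩ := reignition hε hν hT hcan hα1 hcd hlow hmot hreg hblow henv hc0 hc1 hs0 hsT
      (k := 0) (fun n _ => hall n)
    have hL₀₁ : c / 2 * ν ^ 2 < c * ν ^ 2 := by nlinarith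
    have hL₁ : c * ν ^ 2 < ν ^ 2 / 16384 := by rw [lt_div_iff₀ (by norm_num)]; nlinarith
    have hmax := supLevel_maxPrinciple hε hν hcan hα1 hcd hlow hmot hreg hs0 hst₁ ht₁T hL₀₁ hL₁ hall 0
    have hG : 128 * (c * ν ^ 2) * Real.sqrt (c * ν ^ 2) / ν < c * ν ^ 2 := by
      rw [div_lt_iff₀ hν]
      have hsq : Real.sqrt (c * ν ^ 2) < ν / 128 := by
        rw [Real.sqrt_lt' (by positivity)]; nlinarith
      have hpos : 0 < 128 * (c * ν ^ 2) := by positivity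
      nlinarith [mul_lt_mul_of_pos_left hsq hpos]
    have hK : max (c / 2 * ν ^ 2) (128 * (c * ν ^ 2) * Real.sqrt (c * ν ^ 2) / ν) < c * ν ^ 2 := max_lt hL₀₁ hG
    simp only [pow_zero, one_mul, Nat.cast_zero] at hfire hmax
    linarith
  · -- `d ≤ m`: shell `k = m - d` must re-ignite, which takes longer than the clock allows
    obtain ⟨k, rfl⟩ := Nat.exists_eq_add_of_le hmd
    have hdark : ∀ n : ℕ, k < n → (1 + ε₀) ^ n * ‖shellVec X n s‖ ^ 2 ≤ c / 2 * ν ^ 2 :=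
      fun n hn => hno n (by omega)
    have hks : (1 + ε₀) ^ k * ‖shellVec X k s‖ ^ 2 ≤ c / 2 * ν ^ 2 := hno k (by omega)
    obtain ⟨t₁, hst₁, ht₁T, hfire⟩ := reignition hε hν hT hcan hα1 hcd hlow hmot hreg hblow henv hc0 hc1 hs0 hsT hdark
    -- rise time on the window `[s,t₁] ⊂ [0,T')`
    set T' : ℝ := (t₁ + T) / 2 with hT'
    have ht₁T' : t₁ < T' := by rw [hT']; linarith
    have hT'T : T' < T := by rw [hT']; linarith
    have hder := hasDerivWithinAt_window_of_clauses (ε₀ := ε₀) (ν := ν) (α := α) hcd hmot hT'T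
    have henv' : ∀ (m : ℕ) (τ : ℝ), τ ∈ Icc s t₁ → (1 + ε₀) ^ m * ‖shellVec X m τ‖ ^ 2 ≤ C := by
      intro m τ hτ
      have := henv m τ (hs0.trans hτ.1) (lt_of_le_of_lt hτ.2 ht₁T)
      rwa [zpow_natCast] at this
    have hrise := level_growth_le hε hC0 hcan hα1 hder hlow' henv' hs0 hst₁ ht₁T' hν.le k
    -- the clock: `(T - s) λ^{2(d+k)} ≤ K`
    have hclock0 := hFC (d + k) s hs0 hsT ⟨s₀, hs₀, hs₀s, hfired⟩
    rw [le_div_iff₀ (pow_pos hl0 _)] at hclock0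
    set P : ℝ := ((1 + ε₀) ^ 2) ^ d with hPdef
    have hP : 0 < P := by rw [hPdef]; positivity
    have hsplit : (1 + ε₀) ^ (2 * (d + k)) = (1 + ε₀) ^ (2 * k) * P := by
      rw [hPdef, ← pow_mul, ← pow_add]; congr 1; ring
    have hclock : (1 + ε₀) ^ (2 * k) * (t₁ - s) * P ≤ K :=
      calc (1 + ε₀) ^ (2 * k) * (t₁ - s) * P = (t₁ - s) * (1 + ε₀) ^ (2 * (d + k)) := by rw [hsplit]; ring
        _ ≤ (T - s) * (1 + ε₀) ^ (2 * (d + k)) := mul_le_mul_of_nonneg_right (by linarith) (pow_nonneg hl0.le _)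
        _ ≤ K := hclock0
    -- the rise: `cν²/2 < 256 C√C λ^{2k} (t₁ - s)`
    have hrise' : c / 2 * ν ^ 2 < 256 * C * Real.sqrt C * ((1 + ε₀) ^ (2 * k) * (t₁ - s)) := by linarith
    have hCC : 0 ≤ 256 * C * Real.sqrt C := by positivity
    have h1 : c / 2 * ν ^ 2 * P < 256 * C * Real.sqrt C * ((1 + ε₀) ^ (2 * k) * (t₁ - s) * P) := by
      have := mul_lt_mul_of_pos_right hrise' hP
      linarith [this]
    have h2 : 256 * C * Real.sqrt C * ((1 + ε₀) ^ (2 * k) * (t₁ - s) * P) ≤ 256 * C * Real.sqrt C * K :=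
      mul_le_mul_of_nonneg_left hclock hCC
    rw [hPdef] at h1 h2
    linarith

end Summit.NavierStokesRegularity.NavierStokesRegularity.Theorems.MinimalViscousBlowup.ThresholdRay

end
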